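/-
# `Balaban1983to89.B5SupCommutator128` — the sup-norm (`ℓ^∞`) twin of the Schur schema `B5Commutator128` behind (1.128)

statement-level skeleton of published theorems with citation tags; proofs where landed; nothing here is a claim
about the Yang–Mills mass gap

CITATION HEADER (lean-in-tree rule).  Cell `lit-balaban`, unit `lit-balaban-r02` (reader/typer r02 gen 11 = fold owner
of block B5), HOME `run/shared/lean/pub/lit-balaban/` (SKELETON rows B5.Eq1.128, B5.Eq1.126, B5.Prop1.2; owner r02).
B5 = T. Bałaban, *Propagators and renormalization transformations for lattice gauge theories. I*, Commun. Math. Phys.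
**95** (1984) 17–40 [`Balaban1984PropagatorsI`], held as `paper:balaban1984-cmp95-propagators-rt-i` (journal page =
PDF page + 16; p. 38 = render `1984-cmp95-propagators-rt-I-p022-x4.png`, text layer `p0022.txt`, both re-read this
session).  Sibling of pub-balaban b05's `…B5Commutator128` (p180910 / v1.2), whose §§1–6 this module repeats VERBATIM IN
SHAPE on the carrier `ℓ^∞(ι)` (`ι → ℝ` with Mathlib's sup norm) instead of `ℓ²(ι)` (`EuclideanSpace ℝ ι`); the entrywise
lemmas of that module (`entry_three_le`, `sepPos_of_entry_ne`, the exponential bookkeeping `exp_sep_le`,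
`one_le_exp_local`, `mul_exp_half`) are norm-free and are CITED BY NAME, not re-proved.

WHY (the located leaf this serves).  The tree's slot-S1 mechanism `B5SupWalkS1` (r02, p313604) — p. 36: «In the first
step we will show that the inequalities (1.115)–(1.117), (1.89) imply the proposition» — reads the random walk
(1.118)–(1.131) in the PRINTED currency of (1.128), the sup norm `|A| = max_μ sup_x |A_μ(x)|` of (1.108) p. 35: its
representations `B5SupWalkS1.Rep` carry the leaf `h128` «|h_{z₁}K(h_{z₂})A| ≤ O(M₀⁻¹)e^{−2δ₀|z₁−z₂|}(|∇A| + |A|).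
(1.128)» on a real SEMINORMED carrier.  The torus line of seat p38 (`B5WalkH128Torus.h128_holds`, p310676) instantiates
the leaf in the `L²` currency of (1.114) through b05's `ℓ²`-schema `B5Commutator128.h128_schema` (Schur test: row AND
column sums).  On `ℓ^∞` the operator norm of a kernel operator is the maximal absolute ROW sum alone (§2 below), so the
same entry bounds give the sup-currency leaf; this module is that schema — the first brick of the sup-currency
instantiation of `B5SupWalkS1.SupRealisation` on the tori of record (r02's B5-CLOSURE §5 item 2; no SKELETON head moves:
Prop. 1.2 for `G` is already the theorem `B5Prop12GHolds.prop12_famG_printed`).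

WHAT IS PRINTED (p. 38 [PDF 22], verbatim segments; omissions BETWEEN segments only): «Next we have to estimate
|h_{z₁}K(h_{z₂})A|. The operator K(h) is a simple, shortranged, first order differential operator, except the term
P₁(∂h_z). Let us write bounds for the operator ∂P∂*.» … «We obtain |(∂P∂*)_{μ,ν}(x, x′)| ≤ O(1)e^{−δ′₀|x−x′|}, (1.126)»
… «This implies a bound on the operator h_{z₁}K(h_{z₂}). We have to consider separately the cases when □_{z₁}, □_{z₂} are
disjoint, and when they are overlapping. In the first case we have only the operator h_{z₁}P₁(∂h_{z₂}) and (1.126) gives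
a bound with a small factor O(M₀⁻¹) and the exponential factor exp(−⅓δ′₀|z₁ − z₂|) = exp(−⅓δ′₀M₀|z′₁ − z′₂|), where
z′₁, z′₂ are points z₁, z₂ rescaled to the unit scale» … «In the second case we have the small factor O(M₀⁻¹) only, but
we may include the factor exp(−|z′₁ − z′₂|) because |z′₁ − z′₂| ≤ 2d. Defining 2δ₀ = min{⅓δ′₀, M₀⁻¹}, we obtain
|h_{z₁}K(h_{z₂})A| ≤ O(M₀⁻¹)e^{−2δ₀|z₁−z₂|}(|∇A| + |A|). (1.128)».  p. 39 [PDF 23 L7–9]: «… in the estimates of G∇*J we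
have to take a representation of G adjoint to (1.123), with the operators K(h) acting on the right.»

WHAT THIS MODULE KERNEL-CHECKS (an operator-theoretic SCHEMA on `ℓ^∞(ι)`, Mathlib-elementary; NOT Bałaban's operators):
§1 kernel operators `kerOpS k` and multipliers `mulOpS a` on `ι → ℝ` (`(kerOpS k v) i = Σ_j k i j · v j`,
`(mulOpS a v) i = a i · v i`), the commutator identity `mulOpS a * kerOpS k − kerOpS k * mulOpS a = kerOpS ((a_i − a_j)k_ij)`,
`Kop (kerOpS k) (mulOpS ∘ a) z` likewise, and BOTH paired forms — multiplier on the LEFT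
`mulOpS a₁ * [mulOpS a₂, kerOpS k] = kerOpS (a₁ i (a₂ i − a₂ j) k_ij)` (the direct walk (1.123)) and multiplier on the
RIGHT `[mulOpS a₂, kerOpS k] * mulOpS a₁ = kerOpS ((a₂ i − a₂ j) k_ij a₁ j)` («the operators K(h) acting on the right»,
p. 39); the multiplier bound `‖mulOpS a v‖ ≤ C‖v‖` from `|a| ≤ C`;
§2 THE `ℓ^∞` BOUND OF A KERNEL OPERATOR FROM ROW SUMS ALONE: `Σ_j |k i j| ≤ R` for every `i` ⇒ `‖kerOpS k v‖ ≤ R‖v‖`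
(`norm_kerOpS_le`; no column sums — this is the one place where the sup currency is CHEAPER than `L²`), and its decay
form `|k_ij| ≤ B e^{−β dist(π i, π j)}`, row sums `≤ Λ` ⇒ `‖kerOpS k v‖ ≤ BΛ‖v‖`;
§3 THE KERNEL PART OF (1.128) in sup norm («(1.126) gives a bound with a small factor O(M₀⁻¹) and the exponential
factor»): for `|a₁| ≤ 1` supported in the `s`-ball of `c₁`, `a₂` `ℓ`-Lipschitz along `π` supported in the `s`-ball of
`c₂`, `|k_ij| ≤ C e^{−δ dist(π i, π j)}` and row sums `Λ` at rate `δ/8`: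
`‖mulOpS a₁ ([mulOpS a₂, kerOpS k] v)‖ ≤ ℓ·C·(24/(eδ))·Λ·e^{−(5δ/6)(dist(c₁,c₂) − 2s)⁺}·‖v‖` (`norm_three_kernel_leS`, via
b05's `entry_three_le`) and THE SAME BOUND for the right form `‖[mulOpS a₂, kerOpS k] (mulOpS a₁ v)‖` (`norm_kernel_three_leS`:
the entry `(a₂ i − a₂ j)k_ij a₁ j` is b05's entry for the transposed kernel read at `(j, i)`, and the row sum of the
symmetric majorant is again `Λ`); the unpaired form `‖[mulOpS a, kerOpS k] v‖ ≤ ℓ·C·(2/(eδ))·Λ′·‖v‖` («the small factor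
O(M₀⁻¹) only»);
§4 THE LOCAL PART: for a finite-range kernel `l` (`l_ij = 0` beyond distance `ρ`) both paired commutators VANISH when
`dist(c₁,c₂) > 2s + ρ` (`three_local_eq_zeroS`, `local_three_eq_zeroS`); its size enters §5 as the normed hypothesis
`‖[mulOpS (a z), kerOpS l] A‖ ≤ ℓ₁(‖Dg A‖ + ‖A‖)` (the (1.121) computation «K(h)A = Σ_b (∂h)(b)(∂A)(b) − (Δh)A + S*(∂h)QA −
Q*S(∂h)A + P₁(∂h)A» with `∂h = O(M₀⁻¹)`, `Δh = O(M₀⁻²)` — NOT discharged here; for the operator of record it is the sup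
analogue of p38's `B5WalkH128Torus.local_norm_holds`);
§5 ASSEMBLY `h128_schemaS`: for `Δa = kerOpS l + kerOpS k`, `H z = mulOpS (a z)` under `SchemaS` (profiles `|a z| ≤ 1`,
supports in `s`-balls around `c z`, `ℓ`-Lipschitz; `l` of range `ρ` with the local normed hypothesis `ℓ₁`; `|k_ij| ≤
C e^{−δ dist}`; row sums `Λ` at rate `δ/8`), `0 < M₀`, `s ≤ 2M₀` and ANY linear size map `Dg : (ι → ℝ) →ₗ W` into a
seminormed space (model: the gradient into the tensor sections with their sup norm, `|∇A|` of (1.108)):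
`‖H z₁ (Kop Δa H z₂ A)‖ ≤ (ℓ₁·e^{4+ρ/M₀} + ℓ·C·(24/(eδ))·Λ·e^7)·e^{−twoDelta0 δ M₀·dist(c z₁, c z₂)}·(‖Dg A‖ + ‖A‖)` —
EXACTLY the shape of the field `h128` of `B5SupWalk125.SupModel` / `B5SupWalkS1.Rep` (`θ·e^{−2δ₀ dist}·(‖Dg A‖ + ‖A‖)`,
`2δ₀ = twoDelta0 δ′₀ M₀ = min{⅓δ′₀, M₀⁻¹}`, `B5Walk131.twoDelta0`), with `θ = O(M₀⁻¹)` as soon as `ℓ, ℓ₁ = O(M₀⁻¹)`.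
Row sums in the torus model are b05's `B5Commutator128.rowsum_fibre_le` (norm-free, reusable as is).

HONEST SCOPE / DIVERGENCE.  (1) Nothing here is a statement of B5: an abstract `ℓ^∞`-schema whose hypotheses an
instantiation must supply — for Bałaban's `Δ_a = Δ − ∂P∂* + aQ*Q` ((1.69) p. 29) the split into the finite-range part
`Δ + aQ*Q` and the kernel part `−∂P∂*` with (1.126) (PROVED in the tree on the torus: p16's
`B5PBridgeKernel126.holder_GradOp_PcT_GradOp_adjoint`, r02's `B5Kernel126TorusInstance`), the sup-norm local bound `ℓ₁ =
O(M₀⁻¹)` and the uniform row sums — exactly as b05's header says for `ℓ²`.  (2) Same absolute bookkeeping constants as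
b05 (`24/e`, `e^7`, `e^{4+ρ/M₀}`) where print writes O(1); the rate `2δ₀ = min{⅓δ′₀, M₀⁻¹}` is reproduced exactly.
(3) The right form of §3 is provided for the p. 39 adjoint representation; its assembly into an `h128`-shaped field is
left to the instantiation (the size of `h_{z₁}A` versus `A` under `Dg` is a Leibniz matter of the concrete profiles).
(4) Value = the norm half of ONE located leaf of the printed sup/Hölder walk (cell bookkeeping: B5.Eq1.128 «sup-currency
schema», B5.Prop1.2 S1-torus programme file 1), NOT summit progress.
-/
import Mathlib
import Literature.MathematicalPhysics.QuantumFieldTheory.Balaban1983to89.B5Commutator128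

open Finset

namespace Literature.MathematicalPhysics.QuantumFieldTheory.Balaban1983to89.B5SupCommutator128

open B5Local114 (Kop)
open B5Walk131 (twoDelta0 twoDelta0_le_inv)
open B5Commutator128 (entry_three_le sepPos_of_entry_ne exp_sep_le one_le_exp_local mul_exp_half Kop_add)

noncomputable section

/-! ## §1  Kernel operators and multipliers on `ℓ^∞(ι)` and the commutator identities -/

section Kernel

variable {ι : Type}

/-- Multiplication by a real coefficient function `a` on `ℓ^∞(ι)` (model: `A ↦ h_zA`, (1.118) p. 36). [folklore] -/
def mulOpS (a : ι → ℝ) : Module.End ℝ (ι → ℝ) where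
  toFun v := fun i => a i * v i
  map_add' u v := by
    funext i
    simp only [Pi.add_apply, mul_add]
  map_smul' c v := by
    funext i
    simp only [Pi.smul_apply, smul_eq_mul, RingHom.id_apply]
    ring

/-- `(mulOpS a v) i = a i · v i` (folklore). [cite: Balaban1984PropagatorsI, (1.118) p.36 (the multipliers h_z)] -/
@[simp] theorem mulOpS_apply (a : ι → ℝ) (v : ι → ℝ) (i : ι) : mulOpS a v i = a i * v i := rfl

/-- Product of multipliers: `mulOpS a * mulOpS b = mulOpS (ab)` (folklore; model: `Σ_z h_z² = 1`).
[cite: Balaban1984PropagatorsI, (1.118) p.36] -/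
theorem mulOpS_mul (a b : ι → ℝ) : mulOpS a * mulOpS b = mulOpS fun i => a i * b i := by
  apply LinearMap.ext
  intro v
  funext i
  simp only [Module.End.mul_apply, mulOpS_apply, mul_assoc]

/-- A multiplier by a function vanishing identically is `0` (folklore). [cite: Balaban1984PropagatorsI, (1.118) p.36] -/
theorem mulOpS_eq_zero_of_forall {a : ι → ℝ} (h : ∀ i, a i = 0) : mulOpS a = 0 := by
  apply LinearMap.ext
  intro v
  funext i
  simp only [mulOpS_apply, h, zero_mul, LinearMap.zero_apply, Pi.zero_apply]

variable [Fintype ι]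

/-- The operator with matrix / kernel `k` on `ℓ^∞(ι)` (`ι → ℝ` with the sup norm): `(kerOpS k v) i = Σ_j k i j · v j`
(model: a lattice operator acting on sections `A` measured in `|A| = sup_x |A(x)|`, (1.108)).
[cite: Balaban1984PropagatorsI, (1.108) p.35, (1.126) p.38 (operators given by kernels)] -/
def kerOpS (k : ι → ι → ℝ) : Module.End ℝ (ι → ℝ) where
  toFun v := fun i => ∑ j, k i j * v j
  map_add' u v := by
    funext i
    simp only [Pi.add_apply, mul_add, Finset.sum_add_distrib]
  map_smul' c v := by
    funext i
    simp only [Pi.smul_apply, smul_eq_mul, RingHom.id_apply, Finset.mul_sum]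
    exact Finset.sum_congr rfl fun j _ => by ring

/-- `(kerOpS k v) i = Σ_j k i j · v j` (folklore). [cite: Balaban1984PropagatorsI, (1.126) p.38 (operators given by kernels)] -/
@[simp] theorem kerOpS_apply (k : ι → ι → ℝ) (v : ι → ℝ) (i : ι) : kerOpS k v i = ∑ j, k i j * v j := rfl

/-- Left multiplication by a multiplier rescales the rows: `mulOpS a * kerOpS k = kerOpS (a_i k_ij)` (folklore; model:
`hΔ_a` of (1.121)). [cite: Balaban1984PropagatorsI, (1.121) p.37] -/
theorem mulOpS_mul_kerOpS (a : ι → ℝ) (k : ι → ι → ℝ) :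
    mulOpS a * kerOpS k = kerOpS fun i j => a i * k i j := by
  apply LinearMap.ext
  intro v
  funext i
  simp only [Module.End.mul_apply, mulOpS_apply, kerOpS_apply, Finset.mul_sum, mul_assoc]

/-- Right multiplication by a multiplier rescales the columns: `kerOpS k * mulOpS a = kerOpS (k_ij a_j)` (folklore;
model: `Δ_a h` of (1.121)). [cite: Balaban1984PropagatorsI, (1.121) p.37] -/
theorem kerOpS_mul_mulOpS (a : ι → ℝ) (k : ι → ι → ℝ) :
    kerOpS k * mulOpS a = kerOpS fun i j => k i j * a j := by
  apply LinearMap.ext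
  intro v
  funext i
  simp only [Module.End.mul_apply, mulOpS_apply, kerOpS_apply, mul_assoc]

/-- `kerOpS` is additive in the kernel (folklore; model: the sum (1.69) `Δ_a = Δ − ∂P∂* + aQ*Q`).
[cite: Balaban1984PropagatorsI, (1.69) p.29] -/
theorem kerOpS_add (k k' : ι → ι → ℝ) : kerOpS (fun i j => k i j + k' i j) = kerOpS k + kerOpS k' := by
  apply LinearMap.ext
  intro v
  funext i
  simp only [kerOpS_apply, LinearMap.add_apply, Pi.add_apply, add_mul, Finset.sum_add_distrib]

/-- `kerOpS` is subtractive in the kernel (folklore; model: the difference in (1.69)). [cite: Balaban1984PropagatorsI, (1.69) p.29] -/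
theorem kerOpS_sub (k k' : ι → ι → ℝ) : kerOpS (fun i j => k i j - k' i j) = kerOpS k - kerOpS k' := by
  apply LinearMap.ext
  intro v
  funext i
  simp only [kerOpS_apply, LinearMap.sub_apply, Pi.sub_apply, sub_mul, Finset.sum_sub_distrib]

/-- The zero kernel gives the zero operator (folklore; used for the locality of the short-ranged part of `K(h)`).
[cite: Balaban1984PropagatorsI, p.38 («a simple, shortranged, first order differential operator»)] -/
theorem kerOpS_eq_zero_of_forall {k : ι → ι → ℝ} (h : ∀ i j, k i j = 0) : kerOpS k = 0 := by
  apply LinearMap.ext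
  intro v
  funext i
  simp only [kerOpS_apply, h, zero_mul, Finset.sum_const_zero, LinearMap.zero_apply, Pi.zero_apply]

/-- Composition of kernel operators is the kernel operator of the matrix product (folklore; model: `Δ_aG = 1` as
operators). [cite: Balaban1984PropagatorsI, (1.71) p.30] -/
theorem kerOpS_mul_kerOpS (k k' : ι → ι → ℝ) :
    kerOpS k * kerOpS k' = kerOpS fun i j => ∑ m, k i m * k' m j := by
  apply LinearMap.ext
  intro v
  funext i
  simp only [Module.End.mul_apply, kerOpS_apply, Finset.mul_sum, Finset.sum_mul, mul_assoc]
  rw [Finset.sum_comm]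

/-- The Kronecker kernel is the identity operator (folklore; model: the `1` of `Δ_aG = 1`). [cite: Balaban1984PropagatorsI, (1.71) p.30] -/
theorem kerOpS_delta [DecidableEq ι] : kerOpS (fun i j : ι => if i = j then (1 : ℝ) else 0) = 1 := by
  apply LinearMap.ext
  intro v
  funext i
  simp only [kerOpS_apply, ite_mul, one_mul, zero_mul, Finset.sum_ite_eq, Finset.mem_univ, if_true,
    Module.End.one_apply]

/-- **The commutator identity** on `ℓ^∞(ι)`: `mulOpS a * kerOpS k − kerOpS k * mulOpS a = kerOpS ((a_i − a_j) k_ij)`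
(only the DIFFERENCES of the multiplier enter — the lattice form of «a simple, shortranged, first order differential
operator»). [cite: Balaban1984PropagatorsI, p.38 before (1.126)] -/
theorem comm_mulOpS_kerOpS (a : ι → ℝ) (k : ι → ι → ℝ) :
    mulOpS a * kerOpS k - kerOpS k * mulOpS a = kerOpS fun i j => (a i - a j) * k i j := by
  rw [mulOpS_mul_kerOpS, kerOpS_mul_mulOpS, ← kerOpS_sub]
  congr 1
  funext i j
  ring

/-- The commutator `Kop` of `B5Local114` for a kernel operator and a family of multipliers on `ℓ^∞(ι)`:
`Kop (kerOpS k) (mulOpS ∘ a) z = kerOpS ((a z i − a z j) k_ij)`. [cite: Balaban1984PropagatorsI, (1.121) p.37 (the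
operator identity K(h) = hΔ_a − Δ_a h only)] -/
theorem Kop_kerOpS_mulOpS {S : Type} (k : ι → ι → ℝ) (a : S → ι → ℝ) (z : S) :
    Kop (kerOpS k) (fun z => mulOpS (a z)) z = kerOpS fun i j => (a z i - a z j) * k i j := by
  unfold Kop
  exact comm_mulOpS_kerOpS (a z) k

/-- The paired commutator with the multiplier on the LEFT (the direct walk (1.123)) is a kernel operator:
`mulOpS a₁ * (mulOpS a₂ * kerOpS k − kerOpS k * mulOpS a₂) = kerOpS (a₁ i (a₂ i − a₂ j) k_ij)`.
[cite: Balaban1984PropagatorsI, (1.123) p.37, (1.128) p.38] -/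
theorem three_eq_kerOpS (a₁ a₂ : ι → ℝ) (k : ι → ι → ℝ) :
    mulOpS a₁ * (mulOpS a₂ * kerOpS k - kerOpS k * mulOpS a₂)
      = kerOpS fun i j => a₁ i * ((a₂ i - a₂ j) * k i j) := by
  rw [comm_mulOpS_kerOpS, mulOpS_mul_kerOpS]

/-- The paired commutator with the multiplier on the RIGHT («a representation of G adjoint to (1.123), with the
operators K(h) acting on the right», p. 39) is a kernel operator:
`(mulOpS a₂ * kerOpS k − kerOpS k * mulOpS a₂) * mulOpS a₁ = kerOpS ((a₂ i − a₂ j) k_ij a₁ j)`.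
[cite: Balaban1984PropagatorsI, p.39 L7–9] -/
theorem comm_mul_mulOpS_eq_kerOpS (a₁ a₂ : ι → ℝ) (k : ι → ι → ℝ) :
    (mulOpS a₂ * kerOpS k - kerOpS k * mulOpS a₂) * mulOpS a₁
      = kerOpS fun i j => (a₂ i - a₂ j) * k i j * a₁ j := by
  rw [comm_mulOpS_kerOpS, kerOpS_mul_mulOpS]

/-- Every coordinate is bounded by the sup norm: `|v i| ≤ ‖v‖` (folklore; the norm `|A| = sup_x |A(x)|` of (1.108)).
[cite: Balaban1984PropagatorsI, (1.108) p.35] -/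
theorem abs_apply_le_norm (v : ι → ℝ) (i : ι) : |v i| ≤ ‖v‖ := by
  have h := norm_le_pi_norm v i
  rwa [Real.norm_eq_abs] at h

/-- **Multiplier bound in sup norm**: `|a i| ≤ C` for all `i` (`C ≥ 0`) gives `‖mulOpS a v‖ ≤ C‖v‖` (model:
`|h_zA| ≤ |A|` from `0 ≤ h ≤ 1`, the field `normH` of `B5SupWalk125.SupModel`). [cite: Balaban1984PropagatorsI, (1.118) p.36] -/
theorem norm_mulOpS_le {a : ι → ℝ} {C : ℝ} (hC : 0 ≤ C) (ha : ∀ i, |a i| ≤ C) (v : ι → ℝ) :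
    ‖mulOpS a v‖ ≤ C * ‖v‖ := by
  refine (pi_norm_le_iff_of_nonneg (mul_nonneg hC (norm_nonneg v))).mpr fun i => ?_
  rw [Real.norm_eq_abs, mulOpS_apply, abs_mul]
  exact mul_le_mul (ha i) (abs_apply_le_norm v i) (abs_nonneg _) hC

end Kernel

/-! ## §2  The `ℓ^∞`-bound of a kernel operator: absolute ROW sums only -/

section RowSum

variable {ι : Type} [Fintype ι]

/-- **Row-sum bound** (the `ℓ^∞ → ℓ^∞` norm of a kernel operator is the maximal absolute row sum): if every absolute
row sum of `k` is `≤ R`, then `‖kerOpS k v‖ ≤ R‖v‖` — no column sums needed, in contrast with the Schur test of the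
`ℓ²` twin `B5Commutator128.norm_kerOp_le` (folklore; the norm of (1.108) read on a kernel operator).
[cite: Balaban1984PropagatorsI, (1.108) p.35, (1.126) p.38] -/
theorem norm_kerOpS_le {k : ι → ι → ℝ} {R : ℝ} (hR : ∀ i, ∑ j, |k i j| ≤ R) (v : ι → ℝ) :
    ‖kerOpS k v‖ ≤ R * ‖v‖ := by
  rcases isEmpty_or_nonempty ι with hι | ⟨⟨i₀⟩⟩
  · have hv : v = 0 := funext fun i => isEmptyElim i
    have hk : kerOpS k v = 0 := by rw [hv, map_zero]
    rw [hk, hv, norm_zero, mul_zero]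
  have hR0 : 0 ≤ R := le_trans (Finset.sum_nonneg fun j _ => abs_nonneg _) (hR i₀)
  refine (pi_norm_le_iff_of_nonneg (mul_nonneg hR0 (norm_nonneg v))).mpr fun i => ?_
  rw [Real.norm_eq_abs, kerOpS_apply]
  calc |∑ j, k i j * v j| ≤ ∑ j, |k i j * v j| := Finset.abs_sum_le_sum_abs _ _
    _ = ∑ j, |k i j| * |v j| := Finset.sum_congr rfl fun j _ => abs_mul _ _
    _ ≤ ∑ j, |k i j| * ‖v‖ :=
        Finset.sum_le_sum fun j _ => mul_le_mul_of_nonneg_left (abs_apply_le_norm v j) (abs_nonneg _)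
    _ = (∑ j, |k i j|) * ‖v‖ := by rw [Finset.sum_mul]
    _ ≤ R * ‖v‖ := mul_le_mul_of_nonneg_right (hR i) (norm_nonneg _)

variable {X : Type} [PseudoMetricSpace X]

/-- **Row-sum bound, decay form**: `|k_ij| ≤ B e^{−β dist(π i, π j)}` (`B ≥ 0`) and uniform row sums
`Σ_j e^{−β dist(π i, π j)} ≤ Λ` give `‖kerOpS k v‖ ≤ BΛ‖v‖` (folklore; the way (1.126) is used for (1.128)).
[cite: Balaban1984PropagatorsI, (1.126), (1.128) p.38] -/
theorem norm_kerOpS_le_of_decay (π : ι → X) {k : ι → ι → ℝ} {B β Λ : ℝ} (hB : 0 ≤ B)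
    (hk : ∀ i j, |k i j| ≤ B * Real.exp (-(β * dist (π i) (π j))))
    (hΛ : ∀ i, ∑ j, Real.exp (-(β * dist (π i) (π j))) ≤ Λ) (v : ι → ℝ) :
    ‖kerOpS k v‖ ≤ B * Λ * ‖v‖ := by
  have hrow : ∀ i, ∑ j, |k i j| ≤ B * Λ := by
    intro i
    calc ∑ j, |k i j| ≤ ∑ j, B * Real.exp (-(β * dist (π i) (π j))) := Finset.sum_le_sum fun j _ => hk i j
      _ = B * ∑ j, Real.exp (-(β * dist (π i) (π j))) := by rw [Finset.mul_sum]
      _ ≤ B * Λ := mul_le_mul_of_nonneg_left (hΛ i) hB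
  exact norm_kerOpS_le hrow v

/-- **Row-sum bound, transposed decay form** (for operators «acting on the right», p. 39): an entrywise majorant read at
`(j, i)`, `|k_ij| ≤ B e^{−β dist(π j, π i)}`, has the same row sums by the symmetry of `dist`, hence again
`‖kerOpS k v‖ ≤ BΛ‖v‖` (folklore). [cite: Balaban1984PropagatorsI, (1.126), (1.128) p.38, p.39 L7–9] -/
theorem norm_kerOpS_le_of_decay' (π : ι → X) {k : ι → ι → ℝ} {B β Λ : ℝ} (hB : 0 ≤ B)
    (hk : ∀ i j, |k i j| ≤ B * Real.exp (-(β * dist (π j) (π i))))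
    (hΛ : ∀ i, ∑ j, Real.exp (-(β * dist (π i) (π j))) ≤ Λ) (v : ι → ℝ) :
    ‖kerOpS k v‖ ≤ B * Λ * ‖v‖ :=
  norm_kerOpS_le_of_decay π hB (fun i j => by rw [dist_comm]; exact hk i j) hΛ v

end RowSum

/-! ## §3  The kernel part of (1.128) in sup norm: Lipschitz multiplier against a decaying kernel -/

section KernelPart

variable {ι : Type} [Fintype ι] {X : Type} [PseudoMetricSpace X]

/-- **The kernel part of (1.128), multiplier on the left, sup norm**: with `|a₁| ≤ 1` supported in the `s`-ball of `c₁`,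
`a₂` `ℓ`-Lipschitz along `π` (`ℓ ≥ 0`) supported in the `s`-ball of `c₂`, `|k_ij| ≤ C e^{−δ dist(π i, π j)}` and uniform
row sums `Σ_j e^{−(δ/8)dist(π i, π j)} ≤ Λ`:
`‖mulOpS a₁ ([mulOpS a₂, kerOpS k] v)‖ ≤ ℓ·C·(24/(eδ))·Λ·e^{−(5δ/6)(dist(c₁,c₂) − 2s)⁺}·‖v‖` — «(1.126) gives a bound with a
small factor O(M₀⁻¹) and the exponential factor» (entries by b05's `B5Commutator128.entry_three_le`, norm by §2).
[cite: Balaban1984PropagatorsI, p.38 before (1.128)] -/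
theorem norm_three_kernel_leS (π : ι → X) {a₁ a₂ : ι → ℝ} {c₁ c₂ : X} {s ℓ C δ Λ : ℝ} {k : ι → ι → ℝ}
    (hδ : 0 < δ) (hC : 0 ≤ C) (hℓ : 0 ≤ ℓ)
    (hb : ∀ i, |a₁ i| ≤ 1) (h₁ : ∀ i, a₁ i ≠ 0 → dist (π i) c₁ ≤ s)
    (h₂ : ∀ j, a₂ j ≠ 0 → dist (π j) c₂ ≤ s) (hlip : ∀ i j, |a₂ i - a₂ j| ≤ ℓ * dist (π i) (π j))
    (hk : ∀ i j, |k i j| ≤ C * Real.exp (-(δ * dist (π i) (π j))))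
    (hΛ : ∀ i, ∑ j, Real.exp (-(δ / 8 * dist (π i) (π j))) ≤ Λ) (v : ι → ℝ) :
    ‖mulOpS a₁ ((mulOpS a₂ * kerOpS k - kerOpS k * mulOpS a₂) v)‖
      ≤ ℓ * C * (24 / (Real.exp 1 * δ)) * Λ * Real.exp (-(5 * δ / 6 * max 0 (dist c₁ c₂ - 2 * s)))
        * ‖v‖ := by
  have e : mulOpS a₁ ((mulOpS a₂ * kerOpS k - kerOpS k * mulOpS a₂) v)
      = (mulOpS a₁ * (mulOpS a₂ * kerOpS k - kerOpS k * mulOpS a₂)) v := rfl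
  rw [e, three_eq_kerOpS]
  have B0 : 0 ≤ ℓ * C * (24 / (Real.exp 1 * δ)) * Real.exp (-(5 * δ / 6 * max 0 (dist c₁ c₂ - 2 * s))) := by
    positivity
  have main := norm_kerOpS_le_of_decay π B0 (fun i j => entry_three_le π hδ hC hℓ hb h₁ h₂ hlip hk i j) hΛ v
  calc _ ≤ _ := main
    _ = _ := by ring

/-- **The kernel part of (1.128), multiplier on the right, sup norm** («with the operators K(h) acting on the right»,
p. 39): under the hypotheses of `norm_three_kernel_leS`,
`‖[mulOpS a₂, kerOpS k] (mulOpS a₁ v)‖ ≤ ℓ·C·(24/(eδ))·Λ·e^{−(5δ/6)(dist(c₁,c₂) − 2s)⁺}·‖v‖` — the entry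
`(a₂ i − a₂ j)k_ij a₁ j` is b05's entry `a₁ j (a₂ j − a₂ i) kᵀ_ji` for the transposed kernel (same decay majorant by the
symmetry of `dist`), and the row sums of the symmetric majorant are again `≤ Λ`.
[cite: Balaban1984PropagatorsI, p.38 before (1.128), p.39 L7–9] -/
theorem norm_kernel_three_leS (π : ι → X) {a₁ a₂ : ι → ℝ} {c₁ c₂ : X} {s ℓ C δ Λ : ℝ} {k : ι → ι → ℝ}
    (hδ : 0 < δ) (hC : 0 ≤ C) (hℓ : 0 ≤ ℓ)
    (hb : ∀ i, |a₁ i| ≤ 1) (h₁ : ∀ i, a₁ i ≠ 0 → dist (π i) c₁ ≤ s)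
    (h₂ : ∀ j, a₂ j ≠ 0 → dist (π j) c₂ ≤ s) (hlip : ∀ i j, |a₂ i - a₂ j| ≤ ℓ * dist (π i) (π j))
    (hk : ∀ i j, |k i j| ≤ C * Real.exp (-(δ * dist (π i) (π j))))
    (hΛ : ∀ i, ∑ j, Real.exp (-(δ / 8 * dist (π i) (π j))) ≤ Λ) (v : ι → ℝ) :
    ‖(mulOpS a₂ * kerOpS k - kerOpS k * mulOpS a₂) (mulOpS a₁ v)‖
      ≤ ℓ * C * (24 / (Real.exp 1 * δ)) * Λ * Real.exp (-(5 * δ / 6 * max 0 (dist c₁ c₂ - 2 * s)))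
        * ‖v‖ := by
  have e : (mulOpS a₂ * kerOpS k - kerOpS k * mulOpS a₂) (mulOpS a₁ v)
      = ((mulOpS a₂ * kerOpS k - kerOpS k * mulOpS a₂) * mulOpS a₁) v := rfl
  rw [e, comm_mul_mulOpS_eq_kerOpS]
  have B0 : 0 ≤ ℓ * C * (24 / (Real.exp 1 * δ)) * Real.exp (-(5 * δ / 6 * max 0 (dist c₁ c₂ - 2 * s))) := by
    positivity
  -- the transposed kernel obeys the same decay bound
  have hkT : ∀ i j, |(fun i j => k j i) i j| ≤ C * Real.exp (-(δ * dist (π i) (π j))) := by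
    intro i j
    show |k j i| ≤ _
    rw [dist_comm]
    exact hk j i
  have hent : ∀ i j, |(a₂ i - a₂ j) * k i j * a₁ j|
      ≤ ℓ * C * (24 / (Real.exp 1 * δ)) * Real.exp (-(5 * δ / 6 * max 0 (dist c₁ c₂ - 2 * s)))
        * Real.exp (-(δ / 8 * dist (π j) (π i))) := by
    intro i j
    have h := entry_three_le π hδ hC hℓ hb h₁ h₂ hlip hkT j i
    have e2 : (a₂ i - a₂ j) * k i j * a₁ j = -(a₁ j * ((a₂ j - a₂ i) * (fun i j => k j i) j i)) := by
      show (a₂ i - a₂ j) * k i j * a₁ j = -(a₁ j * ((a₂ j - a₂ i) * k i j))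
      ring
    rw [e2, abs_neg]
    exact h
  have main := norm_kerOpS_le_of_decay' π B0 hent hΛ v
  calc _ ≤ _ := main
    _ = _ := by ring

/-- **The unpaired form** («In the second case we have the small factor O(M₀⁻¹) only»): for an `ℓ`-Lipschitz multiplier
and `|k_ij| ≤ C e^{−δ dist}`, `‖[mulOpS a, kerOpS k] v‖ ≤ ℓ·C·(2/(eδ))·Λ′·‖v‖` with `Λ′` the row-sum bound at rate `δ/2`.
[cite: Balaban1984PropagatorsI, p.38 before (1.128)] -/
theorem norm_comm_kernel_leS (π : ι → X) {a : ι → ℝ} {ℓ C δ Λ' : ℝ} {k : ι → ι → ℝ}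
    (hδ : 0 < δ) (hC : 0 ≤ C) (hℓ : 0 ≤ ℓ) (hlip : ∀ i j, |a i - a j| ≤ ℓ * dist (π i) (π j))
    (hk : ∀ i j, |k i j| ≤ C * Real.exp (-(δ * dist (π i) (π j))))
    (hΛ : ∀ i, ∑ j, Real.exp (-(δ / 2 * dist (π i) (π j))) ≤ Λ') (v : ι → ℝ) :
    ‖(mulOpS a * kerOpS k - kerOpS k * mulOpS a) v‖ ≤ ℓ * C * (2 / (Real.exp 1 * δ)) * Λ' * ‖v‖ := by
  rw [comm_mulOpS_kerOpS]
  have B0 : 0 ≤ ℓ * C * (2 / (Real.exp 1 * δ)) := by positivity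
  have hent : ∀ i j, |(a i - a j) * k i j|
      ≤ ℓ * C * (2 / (Real.exp 1 * δ)) * Real.exp (-(δ / 2 * dist (π i) (π j))) := by
    intro i j
    rw [abs_mul]
    have ht0 : 0 ≤ dist (π i) (π j) := dist_nonneg
    calc |a i - a j| * |k i j|
        ≤ (ℓ * dist (π i) (π j)) * (C * Real.exp (-(δ * dist (π i) (π j)))) :=
          mul_le_mul (hlip i j) (hk i j) (abs_nonneg _) (by positivity)
      _ = ℓ * C * (dist (π i) (π j) * Real.exp (-(δ * dist (π i) (π j)))) := by ring
      _ ≤ ℓ * C * (2 / (Real.exp 1 * δ) * Real.exp (-(δ / 2 * dist (π i) (π j)))) :=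
          mul_le_mul_of_nonneg_left (mul_exp_half hδ _) (by positivity)
      _ = _ := by ring
  exact norm_kerOpS_le_of_decay π B0 hent hΛ v

end KernelPart

/-! ## §4  The local part: finite-range kernels -/

section LocalPart

variable {ι : Type} [Fintype ι] {X : Type} [PseudoMetricSpace X]

/-- **Locality of the paired commutator (multiplier on the left) with a finite-range kernel**: if `l_ij = 0` beyond
distance `ρ` and the supports of `a₁`, `a₂` (radius `s` around `c₁`, `c₂`) satisfy `dist(c₁,c₂) > 2s + ρ`, then
`mulOpS a₁ * [mulOpS a₂, kerOpS l] = 0` («K(h) is a simple, shortranged, first order differential operator»: outside the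
reach of □_{z₂} the commutator with the local part does not see h_{z₁}). [cite: Balaban1984PropagatorsI, p.38] -/
theorem three_local_eq_zeroS (π : ι → X) {a₁ a₂ : ι → ℝ} {c₁ c₂ : X} {s ρ : ℝ} {l : ι → ι → ℝ}
    (h₁ : ∀ i, a₁ i ≠ 0 → dist (π i) c₁ ≤ s) (h₂ : ∀ j, a₂ j ≠ 0 → dist (π j) c₂ ≤ s)
    (hl : ∀ i j, ρ < dist (π i) (π j) → l i j = 0) (hT : 2 * s + ρ < dist c₁ c₂) :
    mulOpS a₁ * (mulOpS a₂ * kerOpS l - kerOpS l * mulOpS a₂) = 0 := by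
  rw [three_eq_kerOpS]
  apply kerOpS_eq_zero_of_forall
  intro i j
  by_cases h0 : a₁ i * (a₂ i - a₂ j) = 0
  · rw [← mul_assoc, h0, zero_mul]
  have hi : a₁ i ≠ 0 := fun h => h0 (by rw [h, zero_mul])
  have hij : a₂ i - a₂ j ≠ 0 := fun h => h0 (by rw [h, mul_zero])
  have hD := sepPos_of_entry_ne π h₁ h₂ hi hij
  have hfar : ρ < dist (π i) (π j) := by
    have : dist c₁ c₂ - 2 * s ≤ dist (π i) (π j) := le_trans (le_max_right _ _) hD
    linarith
  rw [hl i j hfar, mul_zero, mul_zero]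

/-- **Locality of the paired commutator (multiplier on the right) with a finite-range kernel**: under the same
hypotheses `[mulOpS a₂, kerOpS l] * mulOpS a₁ = 0` (the transposed picture of `three_local_eq_zeroS`, for the p. 39
adjoint representation). [cite: Balaban1984PropagatorsI, p.38, p.39 L7–9] -/
theorem local_three_eq_zeroS (π : ι → X) {a₁ a₂ : ι → ℝ} {c₁ c₂ : X} {s ρ : ℝ} {l : ι → ι → ℝ}
    (h₁ : ∀ i, a₁ i ≠ 0 → dist (π i) c₁ ≤ s) (h₂ : ∀ j, a₂ j ≠ 0 → dist (π j) c₂ ≤ s)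
    (hl : ∀ i j, ρ < dist (π i) (π j) → l i j = 0) (hT : 2 * s + ρ < dist c₁ c₂) :
    (mulOpS a₂ * kerOpS l - kerOpS l * mulOpS a₂) * mulOpS a₁ = 0 := by
  rw [comm_mul_mulOpS_eq_kerOpS]
  apply kerOpS_eq_zero_of_forall
  intro i j
  by_cases h0 : a₁ j * (a₂ j - a₂ i) = 0
  · have e : (a₂ i - a₂ j) * l i j * a₁ j = -(a₁ j * (a₂ j - a₂ i)) * l i j := by ring
    rw [e, h0, neg_zero, zero_mul]
  have hj : a₁ j ≠ 0 := fun h => h0 (by rw [h, zero_mul])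
  have hji : a₂ j - a₂ i ≠ 0 := fun h => h0 (by rw [h, mul_zero])
  have hD := sepPos_of_entry_ne π h₁ h₂ hj hji
  have hfar : ρ < dist (π i) (π j) := by
    have h' : dist c₁ c₂ - 2 * s ≤ dist (π j) (π i) := le_trans (le_max_right _ _) hD
    rw [dist_comm (π j) (π i)] at h'
    linarith
  rw [hl i j hfar, mul_zero, zero_mul]

end LocalPart

/-! ## §5  Assembly in the shape of `B5SupWalkS1.Rep.h128` / `B5SupWalk125.SupModel.h128` -/

section Assembly

variable {ι : Type} [Fintype ι] {X : Type} [PseudoMetricSpace X]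
  {W : Type} [SeminormedAddCommGroup W] [Module ℝ W]

/-- **The hypotheses of the sup-norm schema** for `Δa = kerOpS l + kerOpS k`, `H z = mulOpS (a z)` on `ℓ^∞(ι)`, with a
linear size map `Dg : (ι → ℝ) →ₗ W` (model: the gradient into the tensor sections with their sup norm): profiles bounded
by `1`, supported in `s`-balls around the centres `c z`, `ℓ`-Lipschitz along `π`; a finite-range part `l` (range `ρ`)
whose commutators with the `H z` obey the NORMED LOCAL HYPOTHESIS `‖[H z, kerOpS l] A‖ ≤ ℓ₁(‖Dg A‖ + ‖A‖)` in sup norm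
(the (1.121) computation with `∂h = O(M₀⁻¹)`, `Δh = O(M₀⁻²)` — NOT discharged in this module); a kernel part `k` with
`|k_ij| ≤ C e^{−δ dist(π i, π j)}` (the role of (1.126)) and uniform row sums `Λ` at rate `δ/8`.  An instantiation
supplies all of it. [cite: Balaban1984PropagatorsI, (1.121) p.37, (1.126) p.38] -/
structure SchemaS (π : ι → X) {S : Type} (a : S → ι → ℝ) (c : S → X) (l k : ι → ι → ℝ)
    (Dg : (ι → ℝ) →ₗ[ℝ] W) (s ℓ ℓ₁ ρ C δ Λ : ℝ) : Prop where
  /-- `|a z i| ≤ 1` -/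
  abs_le : ∀ z i, |a z i| ≤ 1
  /-- `a z` is supported in the `s`-ball of `c z` -/
  supp : ∀ z i, a z i ≠ 0 → dist (π i) (c z) ≤ s
  /-- `a z` is `ℓ`-Lipschitz along `π` -/
  lip : ∀ z i j, |a z i - a z j| ≤ ℓ * dist (π i) (π j)
  /-- `0 ≤ ℓ` -/
  lip_nonneg : 0 ≤ ℓ
  /-- `l` has range `ρ` -/
  range : ∀ i j, ρ < dist (π i) (π j) → l i j = 0
  /-- the normed local hypothesis in sup norm (the (1.121) computation, NOT discharged here) -/
  local_norm : ∀ z A, ‖(mulOpS (a z) * kerOpS l - kerOpS l * mulOpS (a z)) A‖ ≤ ℓ₁ * (‖Dg A‖ + ‖A‖)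
  /-- `0 ≤ ℓ₁` -/
  loc_nonneg : 0 ≤ ℓ₁
  /-- `|k_ij| ≤ C e^{−δ dist(π i, π j)}` (the role of (1.126)) -/
  decay : ∀ i j, |k i j| ≤ C * Real.exp (-(δ * dist (π i) (π j)))
  /-- `0 ≤ C` -/
  C_nonneg : 0 ≤ C
  /-- `0 < δ` -/
  δ_pos : 0 < δ
  /-- uniform row sums at rate `δ/8` -/
  rowsum : ∀ i, ∑ j, Real.exp (-(δ / 8 * dist (π i) (π j))) ≤ Λ

/-- **The sup-norm schema of (1.126) ⟹ (1.128)**: under `SchemaS`, `0 < M₀` and `s ≤ 2M₀`,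
`‖H z₁ (Kop Δa H z₂ A)‖ ≤ (ℓ₁·e^{4+ρ/M₀} + ℓ·C·(24/(eδ))·Λ·e^7)·e^{−twoDelta0 δ M₀·dist(c z₁, c z₂)}·(‖Dg A‖ + ‖A‖)`
for `Δa = kerOpS l + kerOpS k`, `H z = mulOpS (a z)` on `ℓ^∞(ι)` — the SHAPE of the field `h128` of
`B5SupWalk125.SupModel` / `B5SupWalkS1.Rep` in the printed sup currency («|h_{z₁}K(h_{z₂})A| ≤
O(M₀⁻¹)e^{−2δ₀|z₁−z₂|}(|∇A| + |A|). (1.128)», `2δ₀ = min{⅓δ′₀, M₀⁻¹}`), with the constant of order `M₀⁻¹` as soon as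
`ℓ, ℓ₁ = O(M₀⁻¹)`.  The local part is carried by the hypothesis `local_norm` and the proved locality
`three_local_eq_zeroS`; the kernel part is proved (`norm_three_kernel_leS`, b05's `exp_sep_le`).
[cite: Balaban1984PropagatorsI, (1.128) p.38] -/
theorem h128_schemaS {π : ι → X} {S : Type} {a : S → ι → ℝ} {c : S → X} {l k : ι → ι → ℝ}
    {Dg : (ι → ℝ) →ₗ[ℝ] W} {s ℓ ℓ₁ ρ C δ Λ : ℝ}
    (hS : SchemaS π a c l k Dg s ℓ ℓ₁ ρ C δ Λ) {M₀ : ℝ} (hM : 0 < M₀) (hs : s ≤ 2 * M₀)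
    (z₁ z₂ : S) (A : ι → ℝ) :
    ‖mulOpS (a z₁) (Kop (kerOpS l + kerOpS k) (fun z => mulOpS (a z)) z₂ A)‖
      ≤ (ℓ₁ * Real.exp (4 + ρ / M₀) + ℓ * C * (24 / (Real.exp 1 * δ)) * Λ * Real.exp 7)
        * Real.exp (-(twoDelta0 δ M₀ * dist (c z₁) (c z₂))) * (‖Dg A‖ + ‖A‖) := by
  have hT0 : 0 ≤ dist (c z₁) (c z₂) := dist_nonneg
  have hE0 : 0 < Real.exp (-(twoDelta0 δ M₀ * dist (c z₁) (c z₂))) := Real.exp_pos _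
  have hδ := hS.δ_pos
  have hC := hS.C_nonneg
  have hℓ := hS.lip_nonneg
  have hℓ₁ := hS.loc_nonneg
  rcases isEmpty_or_nonempty ι with hι | ⟨⟨i₀⟩⟩
  · -- no components: every vector of `ℓ^∞(∅)` is `0`
    have hz : ∀ w : ι → ℝ, w = 0 := fun w => funext fun i => isEmptyElim i
    have hn : ∀ w : ι → ℝ, ‖w‖ = 0 := fun w => by rw [hz w, norm_zero]
    rw [hn, hn A, hz A, map_zero, norm_zero]
    simp
  have hΛ : 0 ≤ Λ := le_trans (Finset.sum_nonneg fun j _ => (Real.exp_pos _).le) (hS.rowsum i₀)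
  rw [Kop_add, LinearMap.add_apply, map_add]
  -- the local term
  have hloc : ‖mulOpS (a z₁) (Kop (kerOpS l) (fun z => mulOpS (a z)) z₂ A)‖
      ≤ ℓ₁ * Real.exp (4 + ρ / M₀) * Real.exp (-(twoDelta0 δ M₀ * dist (c z₁) (c z₂))) * (‖Dg A‖ + ‖A‖) := by
    rcases lt_or_ge (2 * s + ρ) (dist (c z₁) (c z₂)) with hfar | hnear
    · have h0 : mulOpS (a z₁) * (mulOpS (a z₂) * kerOpS l - kerOpS l * mulOpS (a z₂)) = 0 :=
        three_local_eq_zeroS π (hS.supp z₁) (hS.supp z₂) hS.range hfar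
      have : mulOpS (a z₁) (Kop (kerOpS l) (fun z => mulOpS (a z)) z₂ A) = 0 := by
        have e : mulOpS (a z₁) (Kop (kerOpS l) (fun z => mulOpS (a z)) z₂ A)
            = (mulOpS (a z₁) * (mulOpS (a z₂) * kerOpS l - kerOpS l * mulOpS (a z₂))) A := rfl
        rw [e, h0, LinearMap.zero_apply]
      rw [this, norm_zero]
      positivity
    · have h1 : ‖mulOpS (a z₁) (Kop (kerOpS l) (fun z => mulOpS (a z)) z₂ A)‖
          ≤ 1 * ‖Kop (kerOpS l) (fun z => mulOpS (a z)) z₂ A‖ := norm_mulOpS_le zero_le_one (hS.abs_le z₁) _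
      have h2 : ‖Kop (kerOpS l) (fun z => mulOpS (a z)) z₂ A‖ ≤ ℓ₁ * (‖Dg A‖ + ‖A‖) := hS.local_norm z₂ A
      have h3 : 1 ≤ Real.exp (4 + ρ / M₀) * Real.exp (-(twoDelta0 δ M₀ * dist (c z₁) (c z₂))) :=
        one_le_exp_local hM hs hT0 hnear
      have hn0 : 0 ≤ ‖Dg A‖ + ‖A‖ := by positivity
      calc ‖mulOpS (a z₁) (Kop (kerOpS l) (fun z => mulOpS (a z)) z₂ A)‖
          ≤ ℓ₁ * (‖Dg A‖ + ‖A‖) := by rw [one_mul] at h1; exact h1.trans h2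
        _ = ℓ₁ * (‖Dg A‖ + ‖A‖) * 1 := by ring
        _ ≤ ℓ₁ * (‖Dg A‖ + ‖A‖)
              * (Real.exp (4 + ρ / M₀) * Real.exp (-(twoDelta0 δ M₀ * dist (c z₁) (c z₂)))) :=
            mul_le_mul_of_nonneg_left h3 (by positivity)
        _ = _ := by ring
  -- the kernel term
  have hker : ‖mulOpS (a z₁) (Kop (kerOpS k) (fun z => mulOpS (a z)) z₂ A)‖
      ≤ ℓ * C * (24 / (Real.exp 1 * δ)) * Λ * Real.exp 7
        * Real.exp (-(twoDelta0 δ M₀ * dist (c z₁) (c z₂))) * (‖Dg A‖ + ‖A‖) := by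
    have h1 := norm_three_kernel_leS π hδ hC hℓ (hS.abs_le z₁) (hS.supp z₁) (hS.supp z₂) (hS.lip z₂)
      hS.decay hS.rowsum A
    have h2 := exp_sep_le hδ hM hs hT0
    have hA : ‖A‖ ≤ ‖Dg A‖ + ‖A‖ := le_add_of_nonneg_left (norm_nonneg _)
    have e : mulOpS (a z₁) (Kop (kerOpS k) (fun z => mulOpS (a z)) z₂ A)
        = mulOpS (a z₁) ((mulOpS (a z₂) * kerOpS k - kerOpS k * mulOpS (a z₂)) A) := rfl
    rw [e]
    calc _ ≤ ℓ * C * (24 / (Real.exp 1 * δ)) * Λ * Real.exp (-(5 * δ / 6 * max 0 (dist (c z₁) (c z₂) - 2 * s)))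
          * ‖A‖ := h1
      _ ≤ ℓ * C * (24 / (Real.exp 1 * δ)) * Λ
          * (Real.exp 7 * Real.exp (-(twoDelta0 δ M₀ * dist (c z₁) (c z₂)))) * (‖Dg A‖ + ‖A‖) := by
          apply mul_le_mul _ hA (norm_nonneg _) (by positivity)
          exact mul_le_mul_of_nonneg_left h2 (by positivity)
      _ = _ := by ring
  calc ‖mulOpS (a z₁) (Kop (kerOpS l) (fun z => mulOpS (a z)) z₂ A)
        + mulOpS (a z₁) (Kop (kerOpS k) (fun z => mulOpS (a z)) z₂ A)‖
      ≤ ‖mulOpS (a z₁) (Kop (kerOpS l) (fun z => mulOpS (a z)) z₂ A)‖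
        + ‖mulOpS (a z₁) (Kop (kerOpS k) (fun z => mulOpS (a z)) z₂ A)‖ := norm_add_le _ _
    _ ≤ _ := add_le_add hloc hker
    _ = _ := by ring

/-- **The kernel term with the multiplier on the right, in `h128` units** (for the p. 39 adjoint representation): under
`SchemaS`, `0 < M₀`, `s ≤ 2M₀`,
`‖(Kop (kerOpS k) H z₂) (H z₁ A)‖ ≤ ℓ·C·(24/(eδ))·Λ·e^7·e^{−twoDelta0 δ M₀·dist(c z₁, c z₂)}·‖A‖` — the non-local half of an
`h128`-type bound for «the operators K(h) acting on the right»; the local half (`three_local_eq_zeroS` /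
`local_three_eq_zeroS` + a Leibniz bound for `Dg (h_{z₁}A)`) is the instantiation's business.
[cite: Balaban1984PropagatorsI, (1.128) p.38, p.39 L7–9] -/
theorem kernel_right_le {π : ι → X} {S : Type} {a : S → ι → ℝ} {c : S → X} {l k : ι → ι → ℝ}
    {Dg : (ι → ℝ) →ₗ[ℝ] W} {s ℓ ℓ₁ ρ C δ Λ : ℝ}
    (hS : SchemaS π a c l k Dg s ℓ ℓ₁ ρ C δ Λ) {M₀ : ℝ} (hM : 0 < M₀) (hs : s ≤ 2 * M₀)
    (z₁ z₂ : S) (A : ι → ℝ) :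
    ‖Kop (kerOpS k) (fun z => mulOpS (a z)) z₂ (mulOpS (a z₁) A)‖
      ≤ ℓ * C * (24 / (Real.exp 1 * δ)) * Λ * Real.exp 7
        * Real.exp (-(twoDelta0 δ M₀ * dist (c z₁) (c z₂))) * ‖A‖ := by
  have hT0 : 0 ≤ dist (c z₁) (c z₂) := dist_nonneg
  have hδ := hS.δ_pos
  have hC := hS.C_nonneg
  have hℓ := hS.lip_nonneg
  rcases isEmpty_or_nonempty ι with hι | ⟨⟨i₀⟩⟩
  · have hz : ∀ w : ι → ℝ, w = 0 := fun w => funext fun i => isEmptyElim i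
    have hn : ∀ w : ι → ℝ, ‖w‖ = 0 := fun w => by rw [hz w, norm_zero]
    rw [hn, hn A]
    simp
  have hΛ : 0 ≤ Λ := le_trans (Finset.sum_nonneg fun j _ => (Real.exp_pos _).le) (hS.rowsum i₀)
  have h1 := norm_kernel_three_leS π hδ hC hℓ (hS.abs_le z₁) (hS.supp z₁) (hS.supp z₂) (hS.lip z₂)
    hS.decay hS.rowsum A
  have h2 := exp_sep_le hδ hM hs hT0
  have e : Kop (kerOpS k) (fun z => mulOpS (a z)) z₂ (mulOpS (a z₁) A)
      = (mulOpS (a z₂) * kerOpS k - kerOpS k * mulOpS (a z₂)) (mulOpS (a z₁) A) := rfl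
  rw [e]
  calc _ ≤ ℓ * C * (24 / (Real.exp 1 * δ)) * Λ * Real.exp (-(5 * δ / 6 * max 0 (dist (c z₁) (c z₂) - 2 * s)))
        * ‖A‖ := h1
    _ ≤ ℓ * C * (24 / (Real.exp 1 * δ)) * Λ
        * (Real.exp 7 * Real.exp (-(twoDelta0 δ M₀ * dist (c z₁) (c z₂)))) * ‖A‖ := by
        apply mul_le_mul_of_nonneg_right _ (norm_nonneg _)
        exact mul_le_mul_of_nonneg_left h2 (by positivity)
    _ = _ := by ring

end Assembly

end

end Literature.MathematicalPhysics.QuantumFieldTheory.Balaban1983to89.B5SupCommutator128
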